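/-
Copyright (c) 2026. All rights reserved.
Released under Apache 2.0 license as described in the file LICENSE.
Authors: abc-iut cell, seat abc-iut-w5-d182 (RQ7 kernel probes for abc-iut-L6-t6's
`GlobalFrobenioidModelsTorsorCategory.lean`, p413105).
-/
import Literature.IUT.LogThetaLattice.GlobalFrobenioidModelsTorsorCategory
import HarnessLib

/-!
# [IUTchIII] Example 3.6 (i)/(iii): the divisor of a morphism of `𝓕⊛_MOD` is choice-free

Proof-only companion (RQ7 second-pass kernel probes, abc-iut-w5-d182) of
`GlobalFrobenioidModelsTorsorCategory.lean` (abc-iut-L6-t6, p413105; never edited here).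
S. Mochizuki, *Inter-universal Teichmüller Theory III*, kurims manuscript (May 2020), Example 3.6 (i)
p. 107 l. 10–23, (iii) p. 108 l. 18–22 [claim key Mochizuki2012, status disputed (D-0012)].

The tree gives `𝓕⊛_MOD` its Frobenioid structure by TRANSPORT along the comparison functor
`toFrak : 𝓕⊛_MOD ⥤ 𝓕⊛_𝔪𝔬𝔡`, whose definition CHOOSES, for every object `𝓣`, the witness `t ∈ T` of
condition (b) of Ex. 3.6 (i) (`MODCat.pt`).  Print (p. 107 l. 18–20) speaks of a "natural Frobenioid
structure" on `𝓕⊛_MOD` itself.  The probes below certify that the transported structure is in fact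
intrinsic:

* `MODCat.defect_eq` — the integrality defect `t_{2,v}(φ x) − n · t_{1,v}(x)` of a morphism
  `(n, φ) : 𝓣₁ → 𝓣₂` does not depend on the point `x ∈ T₁`;
* `MODCat.div_toFrak_map_eq_defect` — the zero divisor of the image `(n, φ(t₁) − t₂)` of `(n, φ)` in
  `𝓕⊛_𝔪𝔬𝔡`, i.e. `β_v(φ(t₁) − t₂) + n · 𝔍(𝓣₁)_v − 𝔍(𝓣₂)_v`, EQUALS that defect at every `x` — so the
  divisor assigned to `(n, φ)` by the transported Frobenioid structure is independent of the chosen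
  witnesses `t₁`, `t₂`;
* `MODCat.app_bijective_of_deg_eq_one` / `MODCat.exists_elemHom_of_deg_eq_one` /
  `MODCat.Hom.ofElemHom_injective` — a morphism of Frobenius degree `1` has a BIJECTIVE underlying map,
  hence IS an elementary morphism in abc-iut-L6-t4's sense (`ElemHom`:
  "an isomorphism `T₁ ⥲ T₂` of `F^×_mod`-torsors which is integral at each `v`", p. 107 l. 12–14):
  the converse of `MODCat.Hom.ofElemHom`, so that "the elementary morphisms are precisely the linear
  morphisms" (p. 107 l. 21–22) holds for print's notion of elementary morphism, not only for the
  degree-`1` predicate.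

Theorems only; no new definitions.  HONEST FRAMING: kernel checks
of elementary torsor algebra; nothing here bears on [IUTchIII] Cor. 3.12; typed ≠ endorsed.
-/

noncomputable section

namespace Literature.IUT.LogThetaLattice

namespace GlobalFrobenioidModels

open CategoryTheory Literature.AlgebraicGeometry.Frobenioids

universe u

variable {F : Type u} [Field F] {V : Type u} {Γ : V → Type u} [∀ v, AddCommGroup (Γ v)]
  {nonneg : ∀ v, AddSubmonoid (Γ v)} {β : ∀ v, Additive Fˣ →+ Γ v}

namespace MODCat

/-- The integrality defect `t_{2,v}(φ x) − n · t_{1,v}(x)` of a morphism `(n, φ) : 𝓣₁ → 𝓣₂` of `𝓕⊛_MOD`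
is INDEPENDENT of the point `x ∈ T₁` (because `φ(x) = n·(x − y) + φ(y)` and `t_v` is
`β_v`-equivariant). ([IUTchIII] Ex 3.6 (i) p.107) [claim: Mochizuki2012, status: disputed] -/
theorem defect_eq {X Y : MODCat F V Γ nonneg β} (φ : X ⟶ Y) (v : V) (x y : X.obj.T) :
    Y.obj.t v (app φ x) - ((deg φ : ℕ) : ℤ) • X.obj.t v x =
      Y.obj.t v (app φ y) - ((deg φ : ℕ) : ℤ) • X.obj.t v y := by
  rw [app_eq φ y x, t_vadd (β := β), t_eq (β := β) v y x, map_nsmul, smul_add, ← natCast_zsmul]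
  abel

/-- The zero divisor at `v` of the image `toFrak.map φ = (n, φ(t₁) − t₂)` of a morphism `(n, φ)` in
`𝓕⊛_𝔪𝔬𝔡` — the quantity `β_v(f) + n · 𝔍(𝓣₁)_v − 𝔍(𝓣₂)_v` whose non-negativity is `FrakObj.IsHom` —
EQUALS the intrinsic integrality defect `t_{2,v}(φ x) − n · t_{1,v}(x)` at ANY point `x`.  Hence the
divisor that the transported Frobenioid structure `structureFunctorMOD` assigns to `(n, φ)` does not
depend on the witnesses `t₁ = 𝓣₁.pt`, `t₂ = 𝓣₂.pt` chosen in the definition of `toFrak`.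
([IUTchIII] Ex 3.6 (iii) p.108) [claim: Mochizuki2012, status: disputed] -/
theorem div_toFrak_map_eq_defect {X Y : MODCat F V Γ nonneg β} (φ : X ⟶ Y) (v : V) (x : X.obj.T) :
    β v (Additive.ofMul (FrakCat.fn (toFrak.map φ))) +
        ((FrakCat.deg (toFrak.map φ) : ℕ) : ℤ) • X.frak.cls v - Y.frak.cls v =
      Y.obj.t v (app φ x) - ((deg φ : ℕ) : ℤ) • X.obj.t v x := by
  rw [fn_toFrak_map, deg_toFrak_map, cls_frak, cls_frak, defect_eq φ v x X.pt]
  have e : β v (Additive.ofMul (fnOf φ)) = Y.obj.t v (app φ X.pt) - Y.obj.t v Y.pt := by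
    rw [show fnOf φ = Additive.toMul (app φ X.pt -ᵥ Y.pt) from rfl, ofMul_toMul,
      t_eq (β := β) v Y.pt (app φ X.pt), add_sub_cancel_right]
  rw [e, smul_neg]
  abel

/-- The same identity at the chosen witness: `β_v(φ(t₁) − t₂) + n · 𝔍(𝓣₁)_v − 𝔍(𝓣₂)_v =
t_{2,v}(φ t₁) − n · t_{1,v}(t₁)`. ([IUTchIII] Ex 3.6 (iii) p.108) [claim: Mochizuki2012, status: disputed] -/
theorem div_toFrak_map_eq_defect_pt {X Y : MODCat F V Γ nonneg β} (φ : X ⟶ Y) (v : V) :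
    β v (Additive.ofMul (FrakCat.fn (toFrak.map φ))) +
        ((FrakCat.deg (toFrak.map φ) : ℕ) : ℤ) • X.frak.cls v - Y.frak.cls v =
      Y.obj.t v (app φ X.pt) - ((deg φ : ℕ) : ℤ) • X.obj.t v X.pt :=
  div_toFrak_map_eq_defect φ v X.pt

/-- A morphism of Frobenius degree `1` has a BIJECTIVE underlying map `T₁ → T₂` (an `F^×_mod`-equivariant
map of torsors is a bijection). ([IUTchIII] Ex 3.6 (i) p.107) [claim: Mochizuki2012, status: disputed] -/
theorem app_bijective_of_deg_eq_one {X Y : MODCat F V Γ nonneg β} (φ : X ⟶ Y) (h : deg φ = 1) :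
    Function.Bijective (app φ) := by
  have key : ∀ x : X.obj.T, app φ x = (x -ᵥ X.pt) +ᵥ app φ X.pt := fun x => by
    rw [app_eq φ X.pt x, h, PNat.one_coe, one_smul]
  constructor
  · intro x y hxy
    rw [key x, key y] at hxy
    have h2 : x -ᵥ X.pt = y -ᵥ X.pt := vadd_right_cancel (app φ X.pt) hxy
    rw [← vsub_vadd x X.pt, ← vsub_vadd y X.pt, h2]
  · intro z
    refine ⟨(z -ᵥ app φ X.pt) +ᵥ X.pt, ?_⟩
    rw [key, vadd_vsub]
    exact vsub_vadd z _

/-- A degree-`1` morphism of `𝓕⊛_MOD` IS an elementary morphism in abc-iut-L6-t4's sense (`ElemHom`: an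
isomorphism of `F^×_mod`-torsors, integral at each `v`) — the converse of `MODCat.Hom.ofElemHom`: every
morphism of Frobenius degree `1` is `ofElemHom ψ` for a (unique, by `toFrak_faithful`) elementary morphism
`ψ` with the same underlying map.  So print's "the elementary morphisms are precisely the linear morphisms"
(p. 107 l. 21–22) holds for the PRINTED notion of elementary morphism.
([IUTchIII] Ex 3.6 (i) p.107) [claim: Mochizuki2012, status: disputed] -/
theorem exists_elemHom_of_deg_eq_one {X Y : MODCat F V Γ nonneg β} (φ : X ⟶ Y) (h : deg φ = 1) :
    ∃ ψ : ElemHom (nonneg := nonneg) X.obj Y.obj, (∀ x, ψ.toEquiv x = app φ x) ∧ Hom.ofElemHom ψ = φ := by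
  have h' : Hom.deg φ = 1 := h
  refine ⟨⟨Equiv.ofBijective (app φ) (app_bijective_of_deg_eq_one φ h), fun g x => ?_, fun v x => ?_⟩,
    fun x => rfl, ?_⟩
  · show app φ (g +ᵥ x) = g +ᵥ app φ x
    have := MODCat.Hom.map_vadd φ g x
    rw [h', PNat.one_coe, one_smul] at this
    exact this
  · show Y.obj.t v (app φ x) - X.obj.t v x ∈ nonneg v
    have := MODCat.Hom.integral φ v x
    rw [h', PNat.one_coe, Nat.cast_one, one_zsmul] at this
    exact this
  · exact hom_ext (by rw [deg_ofElemHom]; exact h.symm) rfl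

/-- Degree-`1` morphisms `𝓣₁ → 𝓣₂` correspond BIJECTIVELY to elementary morphisms: `Hom.ofElemHom` is
injective (and, by `exists_elemHom_of_deg_eq_one`, onto the degree-`1` morphisms).
([IUTchIII] Ex 3.6 (i) p.107) [claim: Mochizuki2012, status: disputed] -/
theorem Hom.ofElemHom_injective {X Y : MODCat F V Γ nonneg β} :
    Function.Injective (Hom.ofElemHom (X := X) (Y := Y)) := by
  intro ψ ψ' h
  have happ : ∀ x, ψ.toEquiv x = ψ'.toEquiv x := fun x => by
    have := congrArg (fun χ => app χ x) h
    exact this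
  cases ψ
  cases ψ'
  congr 1
  exact Equiv.ext happ

end MODCat

section Hyps

variable (H : ModelHyps nonneg β)

/-- "the elementary morphisms are precisely the linear morphisms" (p. 107 l. 21–22), for PRINT's notion
of elementary morphism (an integral isomorphism of torsors = abc-iut-L6-t4's `ElemHom`): a morphism of
`𝓕⊛_MOD` is linear for the Frobenioid structure iff it is `ofElemHom` of an elementary morphism.
([IUTchIII] Ex 3.6 (i) p.107) [claim: Mochizuki2012, status: disputed] -/
theorem isLinear_MOD_iff_exists_elemHom {X Y : MODCat F V Γ nonneg β} (φ : X ⟶ Y) :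
    PreFrobenioid.IsLinear (structureFunctorMOD H) φ ↔
      ∃ ψ : ElemHom (nonneg := nonneg) X.obj Y.obj, MODCat.Hom.ofElemHom ψ = φ := by
  rw [isLinear_MOD_iff]
  constructor
  · intro h
    obtain ⟨ψ, -, hψ⟩ := MODCat.exists_elemHom_of_deg_eq_one φ h
    exact ⟨ψ, hψ⟩
  · rintro ⟨ψ, rfl⟩
    exact MODCat.deg_ofElemHom ψ

end Hyps

end GlobalFrobenioidModels

end Literature.IUT.LogThetaLattice
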